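import Mathlib
import HarnessLib
import HarnessLib.Audit
import Summits.KontsevichZagierPeriods.Statement
import Literature.NumberTheory.EllipticCurves.WeierstrassZeta
import HarnessLib.Audit.Status.Attr

/-!
Route: BoundaryLevel

# Route BoundaryLevel — the skin's Hodge level caps a solid's period type — cubic-skin volumes are
2πi × 1-periods, Huber–Wüstholz decides them

It suffices to show VOLUME FORM (frame shared verbatim with routes SymplecticScissors /
HardSphereVirial / SphericalSchlafli, stmt-3814, with the shared Assembly stmt-3822 `VolumeForm →
KontsevichZagierPeriods`): for every N, two integrand-1 representations of dimension N — two
ℚ-semialgebraic sets of finite volume — with the same value are KZ-equivalent. This route realises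
card boundary-hodge-level-caps-solids and owns the LAYER "N = 3 and N = 4, solids whose frontier
lies on a smooth real CUBIC hypersurface transverse to infinity": there the parameter deciding
accessibility is not N but the Hodge LEVEL of the skin. Declared up front: the cruxes are the value
theorem (CubicSkinVolumes: such volumes are 2πi × INCOMPLETE 1-periods of the cubic E at infinity),
the sector instance of VolumeForm that Huber–Wüstholz then decides (CubicSkinScissors), one explicit
egg (EggInstance) and the 4-dimensional clause (CubicThreefoldSolids: 2πi × periods of curve type,
(2πi)² allowed); they are instances and engines of X on the level-one solid sector, not a
decomposition of X.
Lean: `∀ ⦃N : ℕ⦄ (r r' : Literature.NumberTheory.Transcendental.KZ.IntegralRep N), (∀ x ∈ r.domain,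
r.integrand x = 1) → (∀ x ∈ r'.domain, r'.integrand x = 1) → r.value = r'.value →
Literature.NumberTheory.Transcendental.KZ.Equivalent r r'`

## Assembly
The deciding theorem threads the shared frame through the sector crux (rev 3, route-choice
2026-08-16, gate shape route.target-unreachable): `closes (hS : CubicSkinScissors) (hC :
CubicSkinComplement) (hA : Assembly) : KontsevichZagierPeriods := hA (hC hS)` (glue.lean,
sorry-free, native audit ok, axioms standard), with CubicSkinComplement = stmt-14225
(`CubicSkinScissors → VolumeForm`: the declared summit-strength remainder of X off the level-one
solid sector, NOT CLAIMED, the splice point where further skin-level layers attach by glued splits —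
the pattern of Grothendieck.SectorComplement stmt-11102; modulo Assembly it is `CubicSkinScissors →
KontsevichZagierPeriods`, the converse KontsevichZagierPeriods → VolumeForm being proved in the
planner's Sketch.lean since integrand 1 is IsRational) and Assembly = stmt-3822 (VolumeForm →
KontsevichZagierPeriods: Viu-Sos' semi-canonical reduction inside the H21 calculus —
compactification + resolution of poles by moves — shared with SymplecticScissors / HardSphereVirial
/ SphericalSchlafli); rev 0–2 had `closes : VolumeForm → Assembly → KontsevichZagierPeriods`, under
which no item concluded the target. Inside the layer: CubicSkinVolumes places every value in
2πi·Per([ℤ⁶ → E]); Huber–Wüstholz (cited, never imported: HuberWustholz2022 Thm 13.3, tree rendering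
CurvePeriods.HuberWustholzCurvePeriods stays outside the cone) turns "equal volumes" into a
certificate; CubicSkinScissors compiles certificates into moves; EggInstance is the numerical
tripwire; CubicThreefoldSolids extends the value side to N = 4.

Rationale: WHY THIS LINE. Divergence makes Vol(R) = ∫_∂R x₁dx₂dx₃ a period of H²(X°), X° = X ∖ E the smooth
cubic surface minus its smooth hyperplane section at infinity; the Gysin sequence 0 → H²(X)/[E] =
ℚ(−1)⁶ → H²(X°) → H¹(E)(−1) → 0 (DeligneHodgeIII1974 §10, Carlson1980) has weights 2, 3 only, and in
homology H₂(X°) ≅ T([ℤ⁶ → E])(1) is a twisted Deligne 1-motive whose lattice is NS(X)_prim ≅ E₆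
(differences of the 27 lines) restricted to Pic⁰(E) (Looijenga1981, GrossHackingKeel2014: the period
point of the anticanonical pair), algebraically defined and realisation-compatible
(BarbierivialeRosenschonSaito2003, BarbierivialeSrinivas2001, AyoubBarbieriviale2014); hence Vol ∈
2πi·ℚ̄⟨1, ω, η, u(P), ζ(u(P))⟩ with NO π², and every ℚ̄-linear relation among such volumes is an
instance of HuberWustholz2022 Thm 13.3 — isogenies, torsion of the 27 boundary points, functoriality
— i.e. comes with a geometric certificate that CubicSkinScissors must compile into rules 1)–3). For
cubic threefolds (ClemensGriffiths1972, Murre1972) H₃(X°) ≅ T([0 → G])(1), G ∈ Ext(J(X), 𝔾ₘ⁶): still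
1-motivic although X is irrational. Imported: mixed Hodge theory of divisor complements and
1-motives (algebraic geometry), Wüstholz-type transcendence (HuberWustholz2022, Masser1975),
certified volume numerics (LairezMezzarobbaSafeyeldin2019, WeissRamesh2026) for the falsifier. Prior
routes bound level by the integrand (HodgeLevel: level ≤ n−1, silent on 3-dim volumes) or stay in N
= 2 (SymplecticScissors); the negatives index (stmt-5394, convexity) is not touched — every solid
here is cut out explicitly.

RANKED CRUXES. #0 VolumeForm (target) — X — two integrand-1 integral representations of one
dimension N with equal value are KZ-equivalent (shared frame stmt-3814); attacked here on the
level-one solid sector N = 3, 4. (why it might fail: summit-equivalent (CressonViusos2022 §1 via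
ViuSos2021 Thm 1.1): from N = 3 on it contains π², ζ(3) and products of 1-periods (strength
barriers); only the cubic-skin layer is claimed here.) [CressonViusos2022, ViuSos2021,
KontsevichZagier2001]
#2 CubicSkinVolumes (crux) — card K1 typed. F ∈ (ℚ̄∩ℝ)[x,y,z] of degree 3 whose cubic part is the
Weierstrass ternary form y²z − (4x³ − q₂xz² − q₃z³), q₂³ ≠ 27q₃² (E = X∩H∞ smooth, so X̄ is smooth
along E and transverse to H∞; every real smooth cubic at infinity is brought here by a
real-algebraic affine change of coordinates), affine surface smooth over ℂ; R = r.domain bounded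
with frontier R ⊆ {F = 0} (so R is a finite union of bounded complementary regions, ∂R a 2-cycle of
compact components of X°(ℝ)); L any lattice with g₂ = q₂, g₃ = q₃. Then Vol(R) ∈ 2πi·ℚ̄⟨1, ω₁, ω₂,
η₁, η₂, u, ζ_L(u) : ℘_L(u) ∈ ℚ̄⟩ — 2πi × INCOMPLETE first/second-kind periods of E, no (2πi)², no
third kind. [difficulty: L] (why it might fail: rests on H₂(X∖E) ≅ T([NS_prim → E])(1) holding with
ℚ̄-de Rham structures (Deligne's conjecture on 1-motives for H² of an open rational surface, BRS
2003 up to isogeny); a slip in the Type-A/Type-B bookkeeping would put complete third-kind periods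
or (2πi)² in.) [DeligneHodgeIII1974, Carlson1980, Looijenga1981, GrossHackingKeel2014,
BarbierivialeRosenschonSaito2003, HuberWustholz2022]
#3 CubicSkinScissors (crux) — card K2 typed as the sector instance of X: two volume representations
in ℝ³ whose domains are bounded with frontier on smooth cubic skins of the shape of CubicSkinVolumes
(possibly different cubics F, F′ and different curves E, E′ at infinity) and with equal volume are
KZ-equivalent. By CubicSkinVolumes + Huber–Wüstholz the hypothesis "equal volume" is a relation of
bilinearity/functoriality between the 1-motives [ℤ⁶ → E], [ℤ⁶ → E′] (isogeny, torsion of the 27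
boundary points, exact forms); the claim is that each such certificate is a finite chain of rules
1)–3): divergence (one Newton–Leibniz per cylindrical cell, primitive a coordinate) to 2-dim
representations carried by the skin, then Stokes across ℚ-semialgebraic 3-chains of X°(ℂ) ⊂ ℝ⁶
realising [∂R] = tubes over 1-cycles of E + classes of the lines + boundaries. [deps:
CubicSkinVolumes] [difficulty: XL] (why it might fail: the transfer of a Huber–Wüstholz identity
needs semialgebraic Stokes in real dimension 4 through the 24 non-real lines and tube chains near E;
no such chain has been written even for one pair of eggs, and one underivable identity refutes
VolumeForm itself.) [HuberWustholz2022, KontsevichZagier2001, CressonViusos2022,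
SertozOuaknineWorrell2025]
#4 EggInstance (crux) — the cheapest falsifier as a statement: F₀ = y²z − 4x³ + 4xz² + z³ + x² + y²
+ z² − 1/400 (cubic part Weierstrass with g₂ = 4, g₃ = 1, Δ ∝ 37 ≠ 0, non-CM since j = 1728·64/37 ∉
ℤ), R₀ = {F₀ < 0, x²+y²+z² < 1/144} — the egg of radius ≈ 1/20 around 0 (on |p| = 1/12: F₀ ≥ 1/144 −
1/400 − 4.1/1728 > 0.002 and ∂_r F₀ > 0 inside, using |cubic part| ≤ 4.1 on the unit sphere, so ∂R₀
is a whole compact component of {F₀ = 0}): if the affine surface F₀ = 0 is smooth over ℂ (expected,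
generic; first task: Gröbner check), then Vol(R₀) ∈ 2πi·ℚ̄⟨1, ω, η, u, ζ(u)⟩ for the lattice of y² =
4x³ − 4x − 1. [difficulty: L] (why it might fail: only through CubicSkinVolumes — but it is the one
place a 60-digit volume + PSLQ against (π², π, πω₁, πη₁, …) can produce contrary evidence (a robust
π² or log component), and F₀ might be singular (then vacuous: replace 1/400).)
[LairezMezzarobbaSafeyeldin2019, WeissRamesh2026, BreidingKohnSturmfels2024, Masser1975]
#5 CubicThreefoldSolids (crux) — card K4 typed coarsely (sharpened by triage): F ∈ (ℚ̄∩ℝ)[x₁..x₄] of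
degree 3, affine threefold smooth over ℂ, cubic SURFACE at infinity smooth (so X̄ ⊂ ℙ⁴ smooth and
transverse to H∞), R bounded with frontier on {F = 0}: Vol(R) ∈ 2πi·𝒫₁, 𝒫₁ = the ℚ̄-span of periods
of curve type — line integrals ∫_γ ω with Z ⊂ ℂⁿ an embedded smooth affine curve over ℚ̄ (equations
with algebraic coefficients, Jacobian rank n − 1, no isolated points), ω a polynomial 1-form over ℚ̄
and γ a C¹ path on Z with algebraic end points; rev 1 INLINES these data (verbatim the fields of the
tree's CurvePeriods.PeriodSymbol, HuberWustholz2022 Def. 12.6 / Cor. 12.7 / §3.3.1) so that the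
route file no longer imports CurvePeriods.lean (= periods of all 1-motives, contains 2πi, so (2πi)²
= vol(B⁴)·(4/…) is allowed). Mechanism: H₃(X°) ≅ T([0 → G])(1) with G the 𝔾ₘ⁶-extension of the
intermediate Jacobian J(X) classified by Abel–Jacobi images of the 27 lines of the cubic surface at
infinity; h³(X)(1) ≅ h¹(Fano surface) is induced by an algebraic correspondence. [difficulty: L]
(why it might fail: needs the MOTIVIC (ℚ̄-de Rham compatible) identification of H³ of the cubic
threefold with H¹ of its Fano surface/Prym and of the extension by ℚ(−2)⁶ with a 1-motive;
Hodge-theoretically classical, motivically delicate (Nori/André motives of the cubic threefold).)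
[ClemensGriffiths1972, Murre1972, HuberWustholz2022, AyoubBarbieriviale2014, DeligneHodgeIII1974]
#9 EllipsoidCalibration (support) — level 0 in one move (card P2): for a positive-definite symmetric
A ∈ ℚ^{3×3}, the volume representation of the ellipsoid {xᵀAx < 1} and the representation [unit
ball, (det A)^(−1/2)] differ by ONE change of variables (Φ = A^(1/2), real-algebraic entries, |det
Φ| = √det A); the calibration Vol = (4π/3)/√det A ∈ 2π(ℚ̄∩ℝ) of the Tate case H²(quadric ∖ conic) =
ℚ(−1). [difficulty: provable-now] [KontsevichZagier2001, ViuSos2021]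
#9 CubicSkinComplement (support, NOT CLAIMED; rev 3 route-choice) — the SECTOR COMPLEMENT
CubicSkinScissors → VolumeForm: the summit-strength remainder of X outside the level-one solid
sector, filed so that the target is concluded by an item and the sector crux is load-bearing in
`closes`; modulo Assembly (3822) it is `CubicSkinScissors → KontsevichZagierPeriods` (the converse
KontsevichZagierPeriods → VolumeForm is proved in the planner's Sketch.lean: integrand 1 has KZ's
literal rational shape). Nobody is expected to prove it except by proving Conjecture 1 off the
sector; it is the splice point where every further layer (level-0 quadric skins, the planar layer
PlanarAreas 4990, the N = 4 sector instance behind CubicThreefoldSolids, non-transverse/singular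
position, level ≥ 2 skins, unbounded domains) attaches by a glued split NextSector →
SmallerComplement → CubicSkinComplement. [difficulty: open-problem] (why it might fail: it is
Conjecture 1 outside the cubic-skin sector — π², ζ(3), products of 1-periods, K3 periods live there
and the strength barriers bite here and only here on this route.) [KontsevichZagier2001, ViuSos2021,
CressonViusos2022, HuberMullerStach2017]

TWO-LAYER PLAN. Foreseen glued splits (none filed now): CubicSkinScissors ⇐ TorsionCollapse (a
cubic-skin solid whose 27 boundary points generate a torsion subgroup of E is KZ-equivalent to an
algebraic multiple of a ball slab: the torsion-extensions engine one dimension up) → IsogenousSkins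
(eggs whose curves at infinity are isogenous and whose extension points correspond) →
CubicSkinScissors; CubicSkinVolumes ⇐ DivergenceToSkin (one Newton–Leibniz per CAD cell: [R,1] ∼
Σ±[τ_k, branch_k] with graphs on the skin, provable now) → SkinPeriodsAreOneMotivic (the H₂(X°) ≅
T([NS_prim → E])(1) computation with ℚ̄-structures) → CubicSkinVolumes; CubicThreefoldSolids ⇐
FanoCorrespondence → ThreefoldExtension → CubicThreefoldSolids. CubicSkinComplement ⇐ NextSector
(first candidates: level-0 quadric skins = EllipsoidCalibration + slabs; the N = 4 cubic-threefold
sector instance) → SmallerComplement → CubicSkinComplement — the splice pattern, filed only when a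
sector crux closes.

KILL CRITERIA. A refuter showing a weight-4 or third-kind constituent in H₂(X ∖ E) for a smooth
cubic X transverse to H∞ (i.e. ¬CubicSkinVolumes by a Hodge-theoretic witness, or EggInstance
contradicted by a certified high-precision relation with a π²/log term, filed as evidence) closes
the route `refuted:CubicSkinVolumes` — the organising claim is dead. ¬CubicSkinScissors by an
underivable Huber–Wüstholz identity between two eggs refutes VolumeForm and the summit: close
refuted and hand the witness to Neg. CubicThreefoldSolids refuted alone ⇒ drop the N = 4 clause
(pivot: level-one skins in ℙ³ only). VolumeForm or Assembly proved elsewhere moots the route;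
PlanarAreas/CurvePeriodsTransfer (SymplecticScissors) refuted ⇒ the transfer crux here is dead too.
Non-closure of CubicSkinComplement never kills the line (declared remainder, summit strength); its
refutation is a refutation of VolumeForm off the sector, i.e. of the summit — hand the witness to
Neg.

NOT DECOMPOSED YET. The general SKIN LEVEL LEMMA (Vol of a solid with smooth algebraic skin
transverse to infinity is a period of H^{n−1}(X°), whose level is that of H^{n−1}(X), H^{n−2}(C)) is
filed informally only (needs the MixedHodgeStructureOfPair vocabulary already requested by
HodgeLevel, stmt-5103); the 27-lines refinement of CubicSkinVolumes (the divisor is the restriction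
of the root [Σ] ∈ E₆ — needs NS / lines vocabulary) is informal; quadric and quartic skins (level 0
done by EllipsoidCalibration up to slabs; level 2 = K3, out of the decidable zone) are not items;
general position of H∞ (tangent hyperplane, singular E: extra Tate / weight-4 pieces, cf. the
cyclide 2π²Rr²) is excluded by hypothesis, not treated; the Stokes machinery of CubicSkinScissors
(semialgebraic 3-chains in ℝ⁶) is layer 2.

CHEAPEST FALSIFIER. EggInstance numerics: certify Vol(R₀) to ≥ 60 digits (Lairez–Mezzarobba–Safey El
Din Picard–Fuchs method, or adaptive cubature with interval bounds), compute ω₁, η₁ (and ω₂, η₂) of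
y² = 4x³ − 4x − 1, and run PSLQ on {Vol, π, π², πω₁, πη₁, π·Im ω₂, π·Im η₂, 1}: a stable relation
WITH π² (or with log of a small algebraic number) at two precisions is contrary evidence to
CubicSkinVolumes; absence is consistent (the incomplete integrals u(P) of the 27-point divisor are
needed for a positive identification — second stage, after computing the 27 lines of X̄₀
symbolically). Before any numerics: the hand check, done here twice, that H²(X ∖ E) has weights 2, 3
only for X smooth and transverse (no (2πi)² in dimension 3) — it passed; and a Gröbner-basis check
that F₀ = 0 is smooth (not run: the hub is compute-free for planners).

NUMBERS. Calibrations: ball 4π/3 ∈ 2π·ℚ (level 0, H²(quadric ∖ conic) = ℚ(−1)); vol(B⁴) = π²/2 =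
(2πi)²·(−1/8) (N = 4: the weight-4 quotient ℚ(−2) is really there); torus/cyclide 2π²Rr² (singular
along the absolute conic: weight 4 enters once transversality fails). E₆: NS(X)_prim has rank 6, 27
lines, 72 roots; a two-component real cubic surface has exactly 3 real lines and its egg class
satisfies [Σ]² = −χ(S²) = −2 (a root). EggInstance: egg radius ∈ (0.045, 0.057), guard sphere 1/12,
cubic part bounded by 4.1 on the unit sphere, Δ(4, 1) ∝ 64 − 27 = 37. Items at open: 7 (target, 4
cruxes, 1 support, assembly); rev 1: the same 7 (CubicThreefoldSolids restated 1:1, statement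
equivalent by packing/unpacking PeriodSymbol), 1 import dropped. Rev 3 (route-choice 2026-08-16,
operator hold route.target-unreachable on VolumeForm, option (a)): 8 typed items (target, 4 cruxes,
2 supports — EllipsoidCalibration, CubicSkinComplement 14225 — and the assembly) + 2 informal
(TwentySevenLines 11392, SkinLevelLemma 11396) = 10 ≤ 15; `closes` now takes (CubicSkinScissors,
CubicSkinComplement, Assembly).

DEFINITION REQUESTS. None new at open: ℘, PeriodPair.g₂/g₃ (Mathlib) and weierstrassZeta/η₁/η₂
(Literature.NumberTheory.EllipticCurves.WeierstrassZeta) type CubicSkinVolumes / EggInstance;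
CubicThreefoldSolids carries the data of CurvePeriods.PeriodSymbol inlined (rev 1). Rev 1
(route-repair, cone guardrail gen 1, 2026-08-15): the import
Literature.NumberTheory.Transcendental.CurvePeriods — wanted only for that vocabulary, and the
carrier of the cite-only XL fact `HuberWustholzCurvePeriods` into the MODULE import cone — is
dropped; imports are now Statement + WeierstrassZeta; the decl-level cone (`#h21_route_deps`) is 28
project constants, 0 unproved. needs-fact: none — Huber–Wüstholz Thm 13.3 is CITED
(HuberWustholz2022) as the source of the certificates CubicSkinScissors compiles, a hypothesis of no
item; `KZKernelConjecture` / `KZPeriodConjecture'` (PeriodConjecture.lean) reach every route of this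
summit through Summits.KontsevichZagierPeriods.Statement itself (operator file), are
summit-equivalent open conjectures, are named by no item and are not load-bearing here; the informal
SkinLevelLemma reuses the pending request MixedHodgeStructureOfPair (HodgeLevel, stmt-5103). A
notion `NeronSeveriOfCubicSurface`/`LinesOnCubicSurface` would be needed to type the 27-lines
refinement; not requested until CubicSkinVolumes is engaged.

Novelty: Searches (2026-08-15): `lit search --source zbmath "volumes of semialgebraic sets periods"` (7:
LairezMezzarobbaSafeyeldin2019, WeissRamesh2026 =
arXiv:2602.04707, Commelin–Habegger–Huber exponential periods, BreidingKohnSturmfels2024 — volumes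
computed as periods via Picard–Fuchs, no Hodge-level or
transcendence structure); `"transcendence volume semialgebraic"` (6: CressonViusos2022, ViuSos2021,
Kaiser 2024); `"real cubic surface volume"` (8, none
relevant); `"period anticanonical pair rational surface elliptic curve restriction Picard"` (0);
`"mixed Hodge structure complement smooth anticanonical
divisor del Pezzo"` (0); zbMATH lookups Carlson1985 (zbl:0629.14027, one-motif of a SINGULAR
surface), Looijenga1981 / GrossHackingKeel2014 (period point
of (X, E) = restriction E^⊥ → Pic⁰(E), no volumes), BarbierivialeRosenschonSaito2003; `lit galaxy
search "one-motif" / "volume bounded by a cubic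
surface" --star all` (0 relevant); `lit read arxiv:2602.04707 --grep period|elliptic` (Picard–Fuchs
numerics only). Local searchd was unavailable (rc 75)
during the session; the card's own searches (crossref/zbmath, 21 local KZ docs) found nothing on
cubic-skin volumes either.
Nearest prior art found: Looijenga1981 + GrossHackingKeel2014 (the extension dictionary NS_prim →
Pic⁰(E) in print, as a Torelli datum, not as periods of
volumes); LairezMezzarobbaSafeyeldin2019 / WeissRamesh2026 (volumes of semialgebraic sets as
periods, computed, unstructured); HuberWustholz2022 (the
transcenden  [refs: 2602.04707, arxiv:2602.04707, LairezMezzarobbaSafeyeldin2019, WeissRamesh2026, BreidingKohnSturmfels2024, CressonViusos2022, ViuSos2021, Carlson1985, Looijenga1981, GrossHackingKeel2014, BarbierivialeRosenschonSaito2003, HuberWustholz2022]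

Barriers (technique_class: boundary-hodge-level, 1-motives, HW-transfer): - technique_class: boundary-hodge-level, 1-motives, HW-transfer
- Literature.Barriers.KontsevichZagierPeriods.noSemialgebraicPrimitive_inv_sub_two: evaded — the
only primitives used are coordinate functions (divergence, slabs) and closed algebraic forms across
algebraic surfaces (Stokes); elliptic integrals are never integrated out, they are reached as
boundary representations one dimension down.
- Literature.Barriers.KontsevichZagierPeriods.kzConjecture_implies_ellipticPeriods_algIndep: not
engaged — only ℚ̄-LINEAR relations among 1-periods are claimed decided (Huber–Wüstholz, proved),
never algebraic independence of ω₁, ω₂, η₁, η₂; products of solids are outside the layer.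
- Literature.Barriers.KontsevichZagierPeriods.kzConjecture_implies_twoPiI_log_algIndep: not engaged
— weights 2, 3 only in N = 3 (no log·π independence asserted); in N = 4 the (2πi)² term is a
separate Tate summand handled linearly.
- Literature.Barriers.KontsevichZagierPeriods.kzConjecture_implies_oddZetaAlgIndep: not engaged — no
ζ(odd) occurs at level ≤ 1.
- Literature.Barriers.KontsevichZagierPeriods.cressonViuSos_prop_3_2: not engaged — no global
semialgebraic transport map is posited; chains are built per certificate.
- Literature.Barriers.KontsevichZagierPeriods.not_complete_of_undecidable: consistent — on the layer
equality of values is decidable in principle (Sertöz–Ouaknine–Worrell for 1-periods) once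
CubicSkinVolumes is effective, as the summit's decidability consequence demands.
- Negatives in

Novelty grade: new-combination — ROUTE-REVIEW grade (refuter-rreview-0815T17-0-g2-0, 2026-08-16; problem-relative standard): new-combination = (i) MHS-of-the-pair level bookkeeping ⇒ period type (used on this problem by HodgeLevel/HodgeColevel, for the integrand) × (ii) Huber–Wüstholz decidability of ℚ̄-linear 1-period relations as (refuter refuter-rreview-0815T17-0-g2-0, 2026-08-16T01:04:25Z; prior: in-tree route HodgeLevel (stmt-5103 MixedHodgeStructureOfPair level lemma: MHS-of-the-pair bookkeeping bounds period type by the INTEGRAND) — prior use of lever (i) on this problem, in-tree routes SymplecticScissors (CurvePeriodsTransfer/RealOnePeriodRelations; PlanarAreas stmt-4990) and WeightFloor (smooth stones = complete 1-periods) — prior use of lever (ii) HW-transfer on this problem, N = 2, )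

History (route lifecycle, newest last):
- 2026-08-15T17:45:42Z · rev 1: restated CubicThreefoldSolids (stmt-KontsevichZagierPeriods-11390) — route-repair (cone guardrail, gen 1): drop import Literature.NumberTheory.Transcendental.CurvePeriods (carrier of the cite-only XL fact HuberWustholzCurvePeriod (planner-rrepair-KontsevichZagierPeriods-Bounda-97916d64-0)
- 2026-08-16T16:42:19Z · AUTO-CRUX (backfill): CubicSkinComplement — hypotheses of the deciding theorem that nothing in the route derives are cruxes (operator:999:1813213)
- 2026-08-23T23:15:53Z · DORMANT — reconciler: no traction for 6.3 d (last activity item-evidence-added at 2026-08-17T14:49:18Z); parked, not closed — `ledger route dormant route-KontsevichZagier (operator:999:1694701)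
- 2026-08-31T08:38:19Z · REACTIVATED (open) — reconciler: reactivated — activity statement-checked at 2026-08-31T07:27:55Z after parking at 2026-08-23T23:15:53Z (operator:999:641933)

sub-problem: KontsevichZagierPeriods · status: open · opened planner-plancard-KontsevichZagierPeriods-Kont-c000988d-0 2026-08-15T17:28:52Z · rev 4 · ledger route-KontsevichZagierPeriods-BoundaryLevel
GENERATED by the gate from the ledger (D-0016/17). Provers cite these decls: `theorem foo : Summit.KontsevichZagierPeriods.KontsevichZagierPeriods.Theses.BoundaryLevel.<Decl> := …` in Summits/KontsevichZagierPeriods/KontsevichZagierPeriods/Theorems/<Name>.lean.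
-/

namespace Summit.KontsevichZagierPeriods.KontsevichZagierPeriods.Theses.BoundaryLevel

open scoped BigOperators Topology Manifold Classical MeasureTheory ProbabilityTheory Matrix InnerProductSpace ComplexConjugate ContinuousMap
open Filter Set Function TopologicalSpace MeasureTheory

attribute [summit_statement] _root_.KontsevichZagierPeriods

open Literature Periods

/-- item stmt-KontsevichZagierPeriods-3814 · target · rank 0 · open · by planner
why it might fail: summit-equivalent (CressonViusos2022 §1 via ViuSos2021 Thm 1.1): from N = 3 on it contains π², ζ(3) and products of 1-periods (strength barriers); only the cubic-skin layer is claimed here.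
sources: CressonViusos2022, ViuSos2021, KontsevichZagier2001
[target] X — two integrand-1 integral representations of one dimension N with equal value are
KZ-equivalent (volume is the only KZ-invariant of finite-volume ℚ-semialgebraic sets);
summit-equivalent frame of the route, attacked here on the spherical sector. -/
@[route_item "route-KontsevichZagierPeriods-BoundaryLevel"]
def VolumeForm : Prop :=
  ∀ ⦃N : ℕ⦄ (r r' : Literature.NumberTheory.Transcendental.KZ.IntegralRep N), (∀ x ∈ r.domain, r.integrand x = 1) → (∀ x ∈ r'.domain, r'.integrand x = 1) → r.value = r'.value → Literature.NumberTheory.Transcendental.KZ.Equivalent r r'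

/-- item stmt-KontsevichZagierPeriods-11388 · crux · rank 3 · open · by planner
why it might fail: the transfer of a Huber–Wüstholz identity needs semialgebraic Stokes in real dimension 4 through the 24 non-real lines and tube chains near E; no such chain has been written even for one pair of eggs, and one underivable identity refutes VolumeForm itself.
sources: HuberWustholz2022, KontsevichZagier2001, CressonViusos2022, SertozOuaknineWorrell2025
[crux] card K2 typed as the sector instance of X: two volume representations in ℝ³ whose domains are
bounded with frontier on smooth cubic skins of the shape of CubicSkinVolumes (possibly different
cubics F, F′ and different curves E, E′ at infinity) and with equal volume are KZ-equivalent. By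
CubicSkinVolumes + Huber–Wüstholz the hypothesis "equal volume" is a relation of
bilinearity/functoriality between the 1-motives [ℤ⁶ → E], [ℤ⁶ → E′] (isogeny, torsion of the 27
boundary points, exact forms); the claim is that each such certificate is a finite chain of rules
1)–3): divergence (one Newton–Leibniz per cylindrical cell, primitive a coordinate) to 2-dim
representations carried by the skin, then Stokes across ℚ-semialgebraic 3-chains of X°(ℂ) ⊂ ℝ⁶
realising [∂R] = tubes over 1-cycles of E + classes of the lines + boundaries. [deps:
CubicSkinVolumes] [difficulty: XL] -/
@[route_item "route-KontsevichZagierPeriods-BoundaryLevel", crux]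
def CubicSkinScissors : Prop :=
  ∀ (F F' : MvPolynomial (Fin 3) ℝ) (q₂ q₃ q₂' q₃' : ℝ) (r r' : Literature.NumberTheory.Transcendental.KZ.IntegralRep 3), (∀ d, IsAlgebraic ℚ (F.coeff d)) → IsAlgebraic ℚ q₂ → IsAlgebraic ℚ q₃ → q₂ ^ 3 - 27 * q₃ ^ 2 ≠ 0 → F.totalDegree ≤ 3 → MvPolynomial.homogeneousComponent 3 F = MvPolynomial.X 1 ^ 2 * MvPolynomial.X 2 - (4 * MvPolynomial.X 0 ^ 3 - MvPolynomial.C q₂ * MvPolynomial.X 0 * MvPolynomial.X 2 ^ 2 - MvPolynomial.C q₃ * MvPolynomial.X 2 ^ 3) → (∀ z : Fin 3 → ℂ, MvPolynomial.aeval z F = 0 → ∃ i, MvPolynomial.aeval z (MvPolynomial.pderiv i F) ≠ 0) → (∀ x ∈ r.domain, r.integrand x = 1) → Bornology.IsBounded r.domain → frontier r.domain ⊆ {x | MvPolynomial.eval x F = 0} → (∀ d, IsAlgebraic ℚ (F'.coeff d)) → IsAlgebraic ℚ q₂' → IsAlgebraic ℚ q₃' → q₂' ^ 3 - 27 * q₃'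 ^ 2 ≠ 0 → F'.totalDegree ≤ 3 → MvPolynomial.homogeneousComponent 3 F' = MvPolynomial.X 1 ^ 2 * MvPolynomial.X 2 - (4 * MvPolynomial.X 0 ^ 3 - MvPolynomial.C q₂' * MvPolynomial.X 0 * MvPolynomial.X 2 ^ 2 - MvPolynomial.C q₃' * MvPolynomial.X 2 ^ 3) → (∀ z : Fin 3 → ℂ, MvPolynomial.aeval z F' = 0 → ∃ i, MvPolynomial.aeval z (MvPolynomial.pderiv i F') ≠ 0) → (∀ x ∈ r'.domain, r'.integrand x = 1) → Bornology.IsBounded r'.domain → frontier r'.domain ⊆ {x | MvPolynomial.eval x F' = 0} → r.value = r'.value → Literature.NumberTheory.Transcendental.KZ.Equivalent r r'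

/-- item stmt-KontsevichZagierPeriods-14225 · crux (kind.auto-crux: conjecture-grade) · rank 9 · open · by planner
why it might fail: auto-crux — summit-strength (notes:refuter-refute-pool-g48-2): the deciding theorem assumes it and nothing in the route derives it, so it is a bet, not glue
sources: closes-admissibility
[support] SECTOR COMPLEMENT — NOT CLAIMED (route-choice 2026-08-16, option (a) of the operator hold
route.target-unreachable on VolumeForm): CubicSkinScissors → VolumeForm — the summit-strength
remainder of X outside the level-one solid sector, concluding the target itself. The route's cruxes
are a LAYER of X (N = 3 solids with smooth cubic skin transverse to infinity, N = 4 value clause),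
declared at open as "instances and engines of X, not a decomposition of X"; this item is the
declared remainder that gives the target an item concluding it and makes the sector crux
load-bearing in the deciding theorem (`closes (hS : CubicSkinScissors) (hC : CubicSkinComplement)
(hA : Assembly) := hA (hC hS)`), exactly as Grothendieck.SectorComplement (stmt-11102) does for the
lemniscatic sector. Strength, stated openly: the easy direction KontsevichZagierPeriods → VolumeForm
is PROVED in the planner's Sketch.lean (an integrand-1 representation has KZ's literal rational
shape, p = q = 1; axioms propext/choice/Quot.sound), so modulo the shared Assembly stmt-3822 this
item is equivalent to `CubicSkinScissors → KontsevichZagierPeriods` (conjecture / open-problem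
strength). Nobody is expected to prov -/
@[route_item "route-KontsevichZagierPeriods-BoundaryLevel", crux]
def CubicSkinComplement : Prop :=
  CubicSkinScissors → VolumeForm

/-- item stmt-KontsevichZagierPeriods-11387 · aside · rank 2 · open · by planner
why it might fail: rests on H₂(X∖E) ≅ T([NS_prim → E])(1) holding with ℚ̄-de Rham structures (Deligne's conjecture on 1-motives for H² of an open rational surface, BRS 2003 up to isogeny); a slip in the Type-A/Type-B bookkeeping would put complete third-kind periods or (2πi)² in.
sources: DeligneHodgeIII1974, Carlson1980, Looijenga1981, GrossHackingKeel2014, BarbierivialeRosenschonSaito2003, HuberWustholz2022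
[crux] card K1 typed. F ∈ (ℚ̄∩ℝ)[x,y,z] of degree 3 whose cubic part is the Weierstrass ternary form
y²z − (4x³ − q₂xz² − q₃z³), q₂³ ≠ 27q₃² (E = X∩H∞ smooth, so X̄ is smooth along E and transverse to
H∞; every real smooth cubic at infinity is brought here by a real-algebraic affine change of
coordinates), affine surface smooth over ℂ; R = r.domain bounded with frontier R ⊆ {F = 0} (so R is
a finite union of bounded complementary regions, ∂R a 2-cycle of compact components of X°(ℝ)); L any
lattice with g₂ = q₂, g₃ = q₃. Then Vol(R) ∈ 2πi·ℚ̄⟨1, ω₁, ω₂, η₁, η₂, u, ζ_L(u) : ℘_L(u) ∈ ℚ̄⟩ —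
2πi × INCOMPLETE first/second-kind periods of E, no (2πi)², no third kind. [difficulty: L] -/
@[route_item "route-KontsevichZagierPeriods-BoundaryLevel"]
def CubicSkinVolumes : Prop :=
  ∀ (F : MvPolynomial (Fin 3) ℝ) (q₂ q₃ : ℝ) (L : PeriodPair) (r : Literature.NumberTheory.Transcendental.KZ.IntegralRep 3), (∀ d, IsAlgebraic ℚ (F.coeff d)) → IsAlgebraic ℚ q₂ → IsAlgebraic ℚ q₃ → q₂ ^ 3 - 27 * q₃ ^ 2 ≠ 0 → F.totalDegree ≤ 3 → MvPolynomial.homogeneousComponent 3 F = MvPolynomial.X 1 ^ 2 * MvPolynomial.X 2 - (4 * MvPolynomial.X 0 ^ 3 - MvPolynomial.C q₂ * MvPolynomial.X 0 * MvPolynomial.X 2 ^ 2 - MvPolynomial.C q₃ * MvPolynomial.X 2 ^ 3) → (∀ z : Fin 3 → ℂ, MvPolynomial.aeval z F = 0 → ∃ i, MvPolynomial.aeval z (MvPolynomial.pderiv i F) ≠ 0) → L.g₂ = (q₂ : ℂ) → L.g₃ = (q₃ : ℂ) → (∀ x ∈ r.domain, r.integrand x = 1) → Bornology.IsBounded r.domain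 → frontier r.domain ⊆ {x | MvPolynomial.eval x F = 0} → ∃ (k : ℕ) (β w : Fin k → ℂ), (∀ i, IsAlgebraic ℚ (β i)) ∧ (∀ i, w i = 1 ∨ w i = L.ω₁ ∨ w i = L.ω₂ ∨ w i = L.η₁ ∨ w i = L.η₂ ∨ ∃ u : ℂ, u ∉ L.lattice ∧ IsAlgebraic ℚ (L.weierstrassP u) ∧ (w i = u ∨ w i = L.weierstrassZeta u)) ∧ (r.value : ℂ) = 2 * Real.pi * Complex.I * ∑ i, β i * w i

/-- item stmt-KontsevichZagierPeriods-11389 · aside · rank 4 · open · by planner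
why it might fail: only through CubicSkinVolumes — but it is the one place a 60-digit volume + PSLQ against (π², π, πω₁, πη₁, …) can produce contrary evidence (a robust π² or log component), and F₀ might be singular (then vacuous: replace 1/400).
sources: LairezMezzarobbaSafeyeldin2019, WeissRamesh2026, BreidingKohnSturmfels2024, Masser1975
[crux] the cheapest falsifier as a statement: F₀ = y²z − 4x³ + 4xz² + z³ + x² + y² + z² − 1/400
(cubic part Weierstrass with g₂ = 4, g₃ = 1, Δ ∝ 37 ≠ 0, non-CM since j = 1728·64/37 ∉ ℤ), R₀ = {F₀
< 0, x²+y²+z² < 1/144} — the egg of radius ≈ 1/20 around 0 (on |p| = 1/12: F₀ ≥ 1/144 − 1/400 −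
4.1/1728 > 0.002 and ∂_r F₀ > 0 inside, using |cubic part| ≤ 4.1 on the unit sphere, so ∂R₀ is a
whole compact component of {F₀ = 0}): if the affine surface F₀ = 0 is smooth over ℂ (expected,
generic; first task: Gröbner check), then Vol(R₀) ∈ 2πi·ℚ̄⟨1, ω, η, u, ζ(u)⟩ for the lattice of y² =
4x³ − 4x − 1. [difficulty: L] -/
@[route_item "route-KontsevichZagierPeriods-BoundaryLevel"]
def EggInstance : Prop :=
  ∀ (L : PeriodPair) (r : Literature.NumberTheory.Transcendental.KZ.IntegralRep 3), L.g₂ = 4 → L.g₃ = 1 → (∀ x y z : ℂ, y ^ 2 * z - 4 * x ^ 3 + 4 * x * z ^ 2 + z ^ 3 + x ^ 2 + y ^ 2 + z ^ 2 - 1 / 400 = 0 → (-12 * x ^ 2 + 4 * z ^ 2 + 2 * x, 2 * y * z + 2 * y, y ^ 2 + 8 * x * z + 3 * z ^ 2 + 2 * z) ≠ ((0 : ℂ), (0 : ℂ), (0 : ℂ))) → r.domain = {p : Fin 3 → ℝ | (p 1) ^ 2 * p 2 - 4 * (p 0) ^ 3 + 4 * p 0 * (p 2) ^ 2 + (p 2)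 ^ 3 + (p 0) ^ 2 + (p 1) ^ 2 + (p 2) ^ 2 - 1 / 400 < 0 ∧ (p 0) ^ 2 + (p 1) ^ 2 + (p 2) ^ 2 < 1 / 144} → (∀ x ∈ r.domain, r.integrand x = 1) → ∃ (k : ℕ) (β w : Fin k → ℂ), (∀ i, IsAlgebraic ℚ (β i)) ∧ (∀ i, w i = 1 ∨ w i = L.ω₁ ∨ w i = L.ω₂ ∨ w i = L.η₁ ∨ w i = L.η₂ ∨ ∃ u : ℂ, u ∉ L.lattice ∧ IsAlgebraic ℚ (L.weierstrassP u) ∧ (w i = u ∨ w i = L.weierstrassZeta u)) ∧ (r.value : ℂ) = 2 * Real.pi * Complex.I * ∑ i, β i * w i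

-- earlier CubicThreefoldSolids (stmt-KontsevichZagierPeriods-11390, replaced 2026-08-15T17:45:42Z -> stmt-KontsevichZagierPeriods-11434): retired by None — ∀ (F : MvPolynomial (Fin 4) ℝ) (r : Literature.NumberTheory.Transcendental.KZ.IntegralRep 4), (∀ d, IsAlgebraic ℚ (F.coeff d)) → F.totalDegree = 3 → (∀ z : Fin 4 → ℂ, MvPolynomial.aeval z F = 0 → ∃ i, MvPolynomial.aeval z (MvPolynomial.pderiv i F
/-- item stmt-KontsevichZagierPeriods-11434 · aside · rank 5 · open · by planner
why it might fail: needs the MOTIVIC (ℚ̄-de Rham compatible) identification of H³ of the cubic threefold with H¹ of its Fano surface/Prym and of the extension by ℚ(−2)⁶ with a 1-motive; Hodge-theoretically classical, motivically delicate (Nori/André motives of the cubic threefold).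
sources: ClemensGriffiths1972, Murre1972, HuberWustholz2022, AyoubBarbieriviale2014, DeligneHodgeIII1974
[crux] card K4 (the N = 4 clause): F ∈ (ℚ̄∩ℝ)[x₁..x₄] of degree 3, affine threefold {F = 0} smooth
over ℂ, cubic SURFACE at infinity smooth (so X̄ ⊂ ℙ⁴ is smooth and transverse to H∞), R = r.domain
bounded with frontier on {F = 0}, integrand 1: Vol(R) ∈ 2πi·𝒫₁, 𝒫₁ = the ℚ̄-span of periods of curve
type ∫_γ ω — Z ⊂ ℂⁿ an embedded smooth affine curve over ℚ̄ (m equations with algebraic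
coefficients, Jacobian rank n − 1 at every point, no isolated points), ω a polynomial 1-form with
algebraic coefficients, γ : [0,1] → Z a C¹ path with algebraic end points, ∫_γ ω = ∫₀¹ Σⱼ ωⱼ(γ(t))
γⱼ′(t) dt (HuberWustholz2022 Def. 12.6, Cor. 12.7, §3.3.1). Rev 1 (cone repair): these data are
INLINED — they are verbatim the fields of CurvePeriods.PeriodSymbol / CurveData.IsSmoothAffineCurve
/ CurvePath and PeriodSymbol.period, so the statement is equivalent to rev 0's by packing/unpacking
— and the route file no longer imports CurvePeriods.lean. 𝒫₁ = periods of all 1-motives, contains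
2πi, so (2πi)² = −8·vol(B⁴) is allowed. Mechanism: H₃(X°) ≅ T([0 → G])(1) with G the 𝔾ₘ⁶-extension
of the intermediate Jacobian J(X) classified by Abel–Jacobi images of the 27 lines of the cubic
surface at infinity; h³(X)( -/
@[route_item "route-KontsevichZagierPeriods-BoundaryLevel"]
def CubicThreefoldSolids : Prop :=
  ∀ (F : MvPolynomial (Fin 4) ℝ) (r : Literature.NumberTheory.Transcendental.KZ.IntegralRep 4), (∀ d, IsAlgebraic ℚ (F.coeff d)) → F.totalDegree = 3 → (∀ z : Fin 4 → ℂ, MvPolynomial.aeval z F = 0 → ∃ i, MvPolynomial.aeval z (MvPolynomial.pderiv i F) ≠ 0) → (∀ z : Fin 4 → ℂ, z ≠ 0 → MvPolynomial.aeval z (MvPolynomial.homogeneousComponent 3 F) = 0 → ∃ i, MvPolynomial.aeval z (MvPolynomial.pderiv i (MvPolynomial.homogeneousComponent 3 F)) ≠ 0) → (∀ x ∈ r.domain, r.integrand x = 1) → Bornology.IsBounded r.domain → frontier r.domain ⊆ {x | MvPolynomial.eval x F = 0} → ∃ (k : ℕ) (β : Fin k → ℂ) (n m : Fin k → ℕ)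 (G : (i : Fin k) → Fin (m i) → MvPolynomial (Fin (n i)) ℂ) (ω : (i : Fin k) → Fin (n i) → MvPolynomial (Fin (n i)) ℂ) (γ : (i : Fin k) → ℝ → (Fin (n i) → ℂ)), (∀ i, IsAlgebraic ℚ (β i)) ∧ (∀ i l d, IsAlgebraic ℚ ((G i l).coeff d)) ∧ (∀ i j d, IsAlgebraic ℚ ((ω i j).coeff d)) ∧ (∀ i, ∀ z : Fin (n i) → ℂ, (∀ l, MvPolynomial.eval z (G i l) = 0) → Module.finrank ℂ (Submodule.span ℂ (Set.range fun l : Fin (m i) => fun j : Fin (n i) => MvPolynomial.eval z (MvPolynomial.pderiv j (G i l)))) = n i - 1 ∧ z ∈ closure ({z' : Fin (n i) → ℂ | ∀ l, MvPolynomial.eval z' (G i l) = 0} \ {z})) ∧ (∀ i, ContDiffOn ℝ 1 (γ i) (Set.Icc 0 1)) ∧ (∀ i, ∀ t ∈ Set.Icc (0 : ℝ) 1, ∀ l, MvPolynomial.eval (γ i t) (G i l) = 0) ∧ (∀ i j, IsAlgebraic ℚ (γ i 0 j) ∧ IsAlgebraic ℚ (γ i 1 j)) ∧ (r.value : ℂ)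 = 2 * Real.pi * Complex.I * ∑ i, β i * ∫ t in (0 : ℝ)..1, ∑ j, MvPolynomial.eval (γ i t) (ω i j) * deriv (fun u => γ i u j) t

-- item stmt-KontsevichZagierPeriods-11392 · support · rank 6 · open · by planner — informal only, no Lean statement yet:
--   [crux] TwentySevenLines — the PSLQ-sharp refinement of CubicSkinVolumes (card K1: "the 27 lines
--   compute the egg"). Notation of CubicSkinVolumes (F cubic with Weierstrass cubic part, E = X̄ ∩ H∞
--   smooth, affine surface smooth, R bounded with frontier on {F = 0}, L with g₂ = q₂, g₃ = q₃). Let Σ_k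
--   be the compact components of X°(ℝ) bounding R with the orientations ε_k making ∂[R] = Σ ε_k[Σ_k]; α
--   := Σ ε_k[Σ_k] ∈ H₂(X̄(ℂ), ℤ) ∩ [E]^⊥ = NS(X̄)_prim ≅ E₆(−1) (an egg class is a root: [Σ]² = −χ(S²) =
--   −2), written α = Σ n_j (ℓ_j − ℓ′_j) in differences of the 27 lines; D_α := Σ n_j (p_{ℓ_j} −
--   p_{ℓ′_j}) ∈

/-- item stmt-KontsevichZagierPeriods-11391 · support · rank 9 · closed · proved by Summit.KontsevichZagierPeriods.BoundaryLevel.ellipsoidCalibration_proof @ 497ce9f2720a (prover) · by planner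
sources: KontsevichZagier2001, ViuSos2021
[support] level 0 in one move (card P2): for a positive-definite symmetric A ∈ ℚ^{3×3}, the volume
representation of the ellipsoid {xᵀAx < 1} and the representation [unit ball, (det A)^(−1/2)] differ
by ONE change of variables (Φ = A^(1/2), real-algebraic entries, |det Φ| = √det A); the calibration
Vol = (4π/3)/√det A ∈ 2π(ℚ̄∩ℝ) of the Tate case H²(quadric ∖ conic) = ℚ(−1). [difficulty:
provable-now] -/
@[route_item "route-KontsevichZagierPeriods-BoundaryLevel"]
def EllipsoidCalibration : Prop :=
  ∀ (A : Matrix (Fin 3) (Fin 3) ℚ), A.IsSymm → (∀ x : Fin 3 → ℝ, x ≠ 0 → 0 < ∑ i, ∑ j, (A i j : ℝ) * x i * x j) → ∀ (r r' : Literature.NumberTheory.Transcendental.KZ.IntegralRep 3), r.domain = {x | ∑ i, ∑ j, (A i j : ℝ) * x i * x j < 1} → (∀ x ∈ r.domain, r.integrand x = 1) → r'.domain = {x | ∑ i, x i ^ 2 < 1} → (∀ x ∈ r'.domain, r'.integrand x = (Real.sqrt (A.det : ℝ))⁻¹) → Literature.NumberTheory.Transcendental.KZ.of r - Literature.NumberTheory.Transcendental.KZ.of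 r' ∈ Literature.NumberTheory.Transcendental.KZ.changeOfVariablesRel

-- `EllipsoidCalibration` holds: proved by `Summit.KontsevichZagierPeriods.BoundaryLevel.ellipsoidCalibration_proof` @ 497ce9f2720a (its module imports this route file, so no `_holds` link can be stated here).

-- item stmt-KontsevichZagierPeriods-11396 · support · rank 9 · open · by planner — informal only, no Lean statement yet:
--   [support] SkinLevelLemma — the card's mechanism in general form (informal until the
--   mixed-Hodge-structure-of-a-pair vocabulary requested by route HodgeLevel,
--   stmt-KontsevichZagierPeriods-5103 `MixedHodgeStructureOfPair`, lands). X̄ ⊂ ℙⁿ a smooth hypersurface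
--   over ℚ̄ ∩ ℝ, transverse to H∞ with C = X̄ ∩ H∞ smooth, X° = X̄ ∖ C; R ⊂ ℝⁿ bounded ℚ-semialgebraic
--   with frontier R ⊆ X°(ℝ). Then (i) Vol(R) = ⟨x₁ dx₂∧…∧dxₙ|_{X°}, [∂R]⟩ is a period of H_{n−1}(X°)
--   (equivalently of Hⁿ(𝔸ⁿ, X°) ≅ H^{n−1}(X°), 𝔸ⁿ contractible) — one Newton–Leibniz move per
--   cylindrical cell with primitive x₁ realises the diverge

/-- item stmt-KontsevichZagierPeriods-3822 · assembly · rank 1 · closed · proved by Summit.KontsevichZagierPeriods.VolumeFormAssembly.symplecticScissors_assembly_proof (prover) · by planner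
sources: ViuSos2021, CressonViusos2022, KontsevichZagier2001
[assembly] VolumeForm → KontsevichZagierPeriods (difference of volumes + slabs + gluing +
soundness). -/
@[route_item "route-KontsevichZagierPeriods-BoundaryLevel", crux]
def Assembly : Prop :=
  VolumeForm → KontsevichZagierPeriods

-- `Assembly` holds: proved by `Summit.KontsevichZagierPeriods.VolumeFormAssembly.symplecticScissors_assembly_proof` (its module imports this route file, so no `_holds` link can be stated here).

/-! D-0027 §2.1 — DECIDING THEOREM (planner-authored via `route open/edit --closes-file`; by planner-rchoice-KontsevichZagierPeriods-Bounda-77f37300-0 2026-08-16T03:14:08Z):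
its hypotheses are this route's items and its conclusion the sub-problem Statement (glue_lint), and it elaborates with this file. -/

@[closes "route-KontsevichZagierPeriods-BoundaryLevel"] theorem closes (hS : CubicSkinScissors) (hC : CubicSkinComplement) (hA : Assembly) : KontsevichZagierPeriods :=
  hA (hC hS)

end Summit.KontsevichZagierPeriods.KontsevichZagierPeriods.Theses.BoundaryLevel
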